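import Summits.CriticalPhenomena.PercolationContinuityZ3.Theorems.Transplant.BccSlabSqShadow
import Summits.CriticalPhenomena.PercolationContinuityZ3.Theorems.Transplant.SqShadowRouteData
import HarnessLib

/-!
# The bcc (001)-slabs: the radius-`3` vertex routing node `SqShadow.LocalLinkage` FAILS for `BccSlab.sqShadow k`, every `k ≥ 1`
# (a corner vertex of extreme height is reachable only through the two terminals) — the routing certificate must be the EXIT form

builds on p205010 (kernel theorem, internal audit signed; external expert review pending) — NOT used in this file.
Lane `prim-bschramm`, seat `prim-bschramm-p2` (gen 46; class C1b = films / other 3D lattices at their own critical point, METHOD = input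
substitution; memo `HOME/bschramm/P2-LATTICES.md` §156); helper file (`--supports stmt-CriticalPhenomena-4575 --as helper`).

WHY.  «BccSlabSqShadowCritical» reduces `θ_{S_k(bcc)}(p_c) = 0` (p205010-free) to ONE of three finite routing certificates of the square shadow
`BccSlab.sqShadow k` («BccSlabSqShadow»): `LocalLinkage` («SqShadowRouteData»), `ShapedLinkage 3`, or `ShapedLinkageX R` (`R ≥ 1`).  The gen-45 template
(`HOME/prim-bschramm-p2-g45/TEMPLATE-DESIGN.md`) aimed at `LocalLinkage`.  THIS FILE SHOWS THAT NODE IS FALSE for the bcc slabs, for every thickness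
`k ≥ 1`, so the template must discharge the exit form `ShapedLinkageX` instead (as for the thin diamond films, «DiamondFilmSqShadowX»).

THE OBSTRUCTION (no bond of `S_k(bcc)` stays in a column: every bond changes the height by `±1`).  Take the full block pair `sqBlk 0 3 3 ⊆ sqBlk 0 3 3`
(`= sqBall 0 3`), the exit vertex `w' = ((3,3), 0)` — the CORNER column at the BOTTOM layer — and the terminals `E₁ = ((2,3), 1)`, `E₂ = ((3,2), 1)` on the
ring.  The only slab neighbours of `w'` over the block are `E₁` and `E₂` (§1, `eq_E₁_or_E₂_of_adj_W`).  In any routing datum the branch `c :: Br` ends at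
`w'` and is off the rerouted chain `E₁ :: P ++ [E₂]`; so the predecessor of `w'` on it cannot lie in `Br` (it would be `E₁` or `E₂`), hence `Br = [w']` and
the first branch vertex is `b = w'` (§2, `b_eq_W`).  A swap pair `r₁.y = r₂.b`, `r₁.b = r₂.y` would then give `r₁.y = w' = r₁.b`, contradicting `y ≠ b`
(§3, **`BccSlab.not_localLinkage`**).  The same corner obstruction kills `ShapedLinkage(X) R` for the FULL cleared set `W = lift (sqBlkR R z t_D s_D)`; the
cleared set of the exit-form certificate must drop the corner columns (design note `HOME/prim-bschramm-p2-g46/X-TEMPLATE.md`).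
[cite: DuminilCopinSidoraviciusTassion2016, §2.3 (proof of Fact 2: the choice of R and the three disjoint paths)] [cite: ConwaySloane1999, Ch. 4 §7.1]
-/

noncomputable section

namespace Summit.CriticalPhenomena.PercolationContinuityZ3.Theorems.Transplant

namespace BccSlab

open Literature.Probability.Percolation Literature.Probability.LatticeModels SimpleGraph
open scoped Classical

variable {k : ℕ}

/-! ## §1 The three vertices of the obstruction and the neighbours of the corner vertex -/

/-- Along a slab bond the height changes by exactly one. [cite: ConwaySloane1999, Ch. 4 §7.1] -/
theorem abs_height_sub_eq_one {x y : bslab k} (h : (slabGraph k).Adj x y) :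
    |((x : bccSite) : Site 3) 2 - ((y : bccSite) : Site 3) 2| = 1 :=
  bcc_abs_sub_eq_one h 2

/-- The corner exit vertex `w' = ((3,3), 0)` of the obstruction. [folklore] -/
def cexW (k : ℕ) : bslab k := mkV ![3, 3] 0 ⟨3, by simp⟩ le_rfl (by positivity)

/-- The first terminal `E₁ = ((2,3), 1)` of the obstruction (`k ≥ 1`). [folklore] -/
def cexE₁ (hk : 1 ≤ k) : bslab k := mkV ![2, 3] 1 ⟨2, by simp⟩ zero_le_one (by exact_mod_cast hk)

/-- The second terminal `E₂ = ((3,2), 1)` of the obstruction (`k ≥ 1`). [folklore] -/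
def cexE₂ (hk : 1 ≤ k) : bslab k := mkV ![3, 2] 1 ⟨2, by simp⟩ zero_le_one (by exact_mod_cast hk)

/-- Shadow of `w'`. [folklore] -/
@[simp] theorem sh_cexW (k : ℕ) : sh (cexW k) = ![3, 3] := sh_mkV _ _ _ _ _

/-- Shadow of `E₁`. [folklore] -/
@[simp] theorem sh_cexE₁ (hk : 1 ≤ k) : sh (cexE₁ hk) = ![2, 3] := sh_mkV _ _ _ _ _

/-- Shadow of `E₂`. [folklore] -/
@[simp] theorem sh_cexE₂ (hk : 1 ≤ k) : sh (cexE₂ hk) = ![3, 2] := sh_mkV _ _ _ _ _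

/-- Height of `w'`. [folklore] -/
@[simp] theorem height_cexW (k : ℕ) : (((cexW k : bslab k) : bccSite) : Site 3) 2 = 0 := rfl

/-- Height of `E₁`. [folklore] -/
@[simp] theorem height_cexE₁ (hk : 1 ≤ k) : (((cexE₁ hk : bslab k) : bccSite) : Site 3) 2 = 1 := rfl

/-- Height of `E₂`. [folklore] -/
@[simp] theorem height_cexE₂ (hk : 1 ≤ k) : (((cexE₂ hk : bslab k) : bccSite) : Site 3) 2 = 1 := rfl

/-- `E₁ ≠ E₂`. [folklore] -/
theorem cexE₁_ne_cexE₂ (hk : 1 ≤ k) : cexE₁ hk ≠ cexE₂ hk := by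
  intro h
  have := congrArg (fun x : bslab k => sh x 0) h
  simp at this

/-- **The corner vertex of the bottom layer has only two slab neighbours over the block**: a neighbour of `w' = ((3,3),0)` whose column lies in
`sqBall 0 3` is `E₁ = ((2,3),1)` or `E₂ = ((3,2),1)` (its height is `1`, its column is `(3,3) ± eᵢ` inside the square). [cite: ConwaySloane1999, Ch. 4 §7.1] -/
theorem eq_E₁_or_E₂_of_adj_W (hk : 1 ≤ k) {p : bslab k} (hadj : (slabGraph k).Adj p (cexW k)) (hp : sh p ∈ sqBall (0 : Site 2) 3) :
    p = cexE₁ hk ∨ p = cexE₂ hk := by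
  have hh : ((p : bccSite) : Site 3) 2 = 1 := by
    have h1 := abs_height_sub_eq_one hadj
    rw [height_cexW, sub_zero] at h1
    have h0 : 0 ≤ ((p : bccSite) : Site 3) 2 := (mem_bslab.1 p.2).1
    rw [abs_of_nonneg h0] at h1
    exact h1
  have hst := sh_step hadj
  rw [sh_cexW, zdGraph_adj_iff] at hst
  rw [mem_sqBall_iff_linear] at hp
  obtain ⟨i, hi⟩ := hst
  have e0 : sh p 0 = 2 ∧ sh p 1 = 3 ∨ sh p 0 = 3 ∧ sh p 1 = 2 := by
    rcases hi with hi | hi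
    · have c0 := congrFun hi 0
      have c1 := congrFun hi 1
      fin_cases i <;> simp at c0 c1 <;> omega
    · have c0 := congrFun hi 0
      have c1 := congrFun hi 1
      fin_cases i <;> simp at c0 c1 <;> [skip; skip] <;> simp only [Fin.isValue, Pi.zero_apply] at hp <;> omega
  rcases e0 with ⟨c0, c1⟩ | ⟨c0, c1⟩
  · left
    refine eq_of_sh_eq_of_height_eq ?_ (by rw [hh, height_cexE₁])
    rw [sh_cexE₁]; ext j; fin_cases j <;> simp [c0, c1]
  · right
    refine eq_of_sh_eq_of_height_eq ?_ (by rw [hh, height_cexE₂])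
    rw [sh_cexE₂]; ext j; fin_cases j <;> simp [c0, c1]

/-! ## §2 Every routing datum for the obstruction triple has `b = w'` -/

/-- **In every routing datum for `(E₁, E₂, w')` over the full block the branch is `[w']`, so `b = w'`**: the predecessor of `w'` on the branch chain
`c :: Br` is adjacent to `w'` and, if it lay in `Br`, would be over the block and off the rerouted chain — but the only such neighbours are the terminals
`E₁, E₂`, which are ON the rerouted chain. [cite: DuminilCopinSidoraviciusTassion2016, §2.3 (proof of Fact 2)] -/
theorem b_eq_W (hk : 1 ≤ k) {RP D : Set (Site 2)} (hD : D ⊆ sqBall (0 : Site 2) 3)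
    (r : (sqShadow k).RouteData RP D (cexE₁ hk) (cexE₂ hk) (cexW k)) : r.b = cexW k := by
  obtain ⟨Br', hBr'⟩ : ∃ Br' : List (bslab k), r.Br = Br' ++ [cexW k] := by
    refine ⟨r.Br.dropLast, ?_⟩
    have h := List.dropLast_append_getLast r.hBr
    rw [r.hBrlast] at h
    exact h.symm
  by_cases hnil : Br' = []
  · rw [hnil, List.nil_append] at hBr'
    simp only [SqShadow.RouteData.b, hBr', List.head_cons]
  · exfalso
    set p : bslab k := Br'.getLast hnil with hp
    have hpBr' : p ∈ Br' := List.getLast_mem hnil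
    have hpBr : p ∈ r.Br := by rw [hBr']; exact List.mem_append_left _ hpBr'
    have hadj : (slabGraph k).Adj p (cexW k) := by
      have hch := r.hBrchain
      rw [hBr', ← List.cons_append, List.isChain_append] at hch
      obtain ⟨-, -, hlast⟩ := hch
      refine hlast p ?_ (cexW k) (by simp)
      rw [List.getLast?_eq_getLast_of_ne_nil (List.cons_ne_nil _ _), List.getLast_cons hnil]
      rfl
    have hpD : sh p ∈ sqBall (0 : Site 2) 3 := by
      have := hD (r.hBrD p hpBr)
      rwa [sqShadow_sh] at this
    have hpSP := r.hBrSP p hpBr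
    rcases eq_E₁_or_E₂_of_adj_W hk hadj hpD with h | h
    · exact hpSP (by rw [h]; exact List.mem_cons_self)
    · exact hpSP (by rw [h]; simp)

/-! ## §3 The node fails -/

/-- **`SqShadow.LocalLinkage` FAILS FOR THE bcc (001)-SLAB `S_k(bcc)`, EVERY `k ≥ 1`.**  At `z = 0`, `t_R = t_D = s_R = s_D = 3` (full blocks
`sqBall 0 3`), with `E₁ = ((2,3),1)`, `E₂ = ((3,2),1)` on the ring and the corner exit vertex `w' = ((3,3),0)`, every routing datum has `b = w'`
(`b_eq_W`); a swap pair would give `r₁.y = r₂.b = w' = r₁.b`, contradicting `y ≠ b`.  Consequence for the lane: the p205010-free certificate for the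
bcc slabs is the EXIT form `ShapedLinkageX R` of «SqShadowVRouteDataX» with a cleared set `W` that DROPS THE CORNER COLUMNS of the block (then no
cleared vertex has all its cleared neighbours in two columns), never `LocalLinkage` and never the full lift as `W`. [cite: DuminilCopinSidoraviciusTassion2016, §2.3 (proof of Fact 2: "Fix R in such a way that …
there exist three disjoint self-avoiding paths")] -/
theorem not_localLinkage (hk : 1 ≤ k) : ¬ (sqShadow k).LocalLinkage := by
  intro hL
  have hfull : sqBlk (0 : Site 2) 3 3 = sqBall (0 : Site 2) 3 := sqBlk_eq_sqBall 0 le_rfl le_rfl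
  have hE₁B : (sqShadow k).sh (cexE₁ hk) ∈ sqBlk (0 : Site 2) 3 3 := by
    rw [hfull, sqShadow_sh, sh_cexE₁, mem_sqBall_iff_linear]; simp
  have hE₁S : (sqShadow k).sh (cexE₁ hk) ∈ sqRing (0 : Site 2) 3 := by
    rw [sqShadow_sh, sh_cexE₁, mem_sqRing_iff_linear, mem_sqBall_iff_linear]; simp
  have hE₂B : (sqShadow k).sh (cexE₂ hk) ∈ sqBlk (0 : Site 2) 3 3 := by
    rw [hfull, sqShadow_sh, sh_cexE₂, mem_sqBall_iff_linear]; simp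
  have hE₂S : (sqShadow k).sh (cexE₂ hk) ∈ sqRing (0 : Site 2) 3 := by
    rw [sqShadow_sh, sh_cexE₂, mem_sqRing_iff_linear, mem_sqBall_iff_linear]; simp
  have hWB : (sqShadow k).sh (cexW k) ∈ sqBlk (0 : Site 2) 3 3 := by
    rw [hfull, sqShadow_sh, sh_cexW, mem_sqBall_iff_linear]; simp
  have hWz : (sqShadow k).sh (cexW k) ≠ 0 := by
    rw [sqShadow_sh, sh_cexW]; intro h; have := congrFun h 0; simp at this
  have hW1 : (sqShadow k).sh (cexW k) ≠ (sqShadow k).sh (cexE₁ hk) := by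
    rw [sqShadow_sh, sh_cexW, sh_cexE₁]; intro h; have := congrFun h 0; simp at this
  have hW2 : (sqShadow k).sh (cexW k) ≠ (sqShadow k).sh (cexE₂ hk) := by
    rw [sqShadow_sh, sh_cexW, sh_cexE₂]; intro h; have := congrFun h 1; simp at this
  obtain ⟨r₁, r₂, hy, hb⟩ := hL 0 3 3 3 3 le_rfl le_rfl (Or.inl le_rfl) (cexE₁ hk) (cexE₂ hk) (cexW k) (cexE₁_ne_cexE₂ hk)
    hE₁B hE₁S hE₂B hE₂S hWB hWz hW1 hW2
  have h1 : r₁.b = cexW k := b_eq_W hk (sqBlk_subset_sqBall 0 3 3) r₁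
  have h2 : r₂.b = cexW k := b_eq_W hk (sqBlk_subset_sqBall 0 3 3) r₂
  exact r₁.y_ne_b (by rw [hy, h2, h1])

end BccSlab

end Summit.CriticalPhenomena.PercolationContinuityZ3.Theorems.Transplant

end
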